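import Summits.QuantumFields.BalabanUV.T4Continuum.Support.NE9BridgeSizeInductionOn
import Summits.QuantumFields.BalabanUV.T4Continuum.Support.NE9SizeFedCoupling

/-!
# NE9EndChainOn — LOCATED CORRECTION O-ne9p1g32-1 of the END's BOX BINDER, kernel part 2: the PASS-THROUGH layers of the END
# chain of record re-cut with the box read-out at ARISING tables (`hboxOn`) — END-M `…_compProj`, the size-first face
# `termSize_compProj`, the size-fed faces `…_compProj_fed` ∕ `…_margProj_fed`
# (cell `pub-balaban`, T4-DAG §2 node U3 ∕ §6 NE9; BINDER row NE9 OWNER lineage `b2b-balaban-t4-ne9-p1`, generation 32;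
# sheet `t4/b2b-balaban-t4-ne9-p1/g32/TABLE-HALF-NE9-g32.md` §2 = finding OBJ-NE9-g32-1; part 1 = `NE9BridgeSizeInductionOn`)

HONEST FRAMING (T4-DAG PAGE 1).  Rung (B)+1 of the FINITE-VOLUME T⁴ programme — NOT infinite volume, NOT a mass gap, NOT the
Clay problem.  NE9 (`T4OutputRate.NE9` ∧ `FadingMemory`) is a cell NEW ESTIMATE, NOT PRINTED in [I] = [Balaban1987RG1]
(CMP **109**), [II] = [Balaban1988RG2Cluster] (CMP **116**), NOT discharged here («NE9 ⇐ the named binders»; 0∕18 leaves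
instantiated on Bałaban's objects; spine PROVED 0∕9).  HONEST DEPENDENCY (cell line, verbatim): continuum YM on T⁴ ⇐ BetaPertH ∧
nine spine estimates (0/9 proved); BetaPertH ⇐ (D1) ∧ (D4) ∧ CAP+tail; G-an2-4 gates asym, D1 and NE2/3/4.  `FlowStep.BetaPertH`,
(B), (B^μ) do not occur.  Bookkeeping over the ABSTRACT carriers; quotations for TYPES only (ABSOLUTE RULE).  0 sorry.

WHAT.  The END chain of record (T4 = `NE9SizeFedCouplingSpeciesReadOut.…_margProj_fedA3`, p216114) threads the box read-out
`hbox : ∀ k Q, (box bound) → ρ k Q ∈ 𝒜 k` FOR EVERY TABLE OF THE WEIGHTED BOX through five layers down to its only consumer, the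
size induction (`NE9BridgeSizeInduction.termSize_of_recursion_vacSub`), which applies it at ARISING tables `T k g′ (E g)` only.
Part 1 re-cut the consumer and the bridge END (`…_on`, binder `hboxOn`).  THIS FILE re-cuts the three pass-through layers between
them and the species faces, VERBATIM but for `hbox ↦ hboxOn` (at `T := compProj 𝒯 P`) and the callee `↦ …_on`:
* §1 **`ne9_and_fadingMemory_of_couplingTwoPoint_vacSub_sizeInduction_compProj_on`** — END-M `…_compProj`
  (`NE9MarginalProjectionEnd`, p208940) re-cut;
* §2 **`termSize_compProj_on`**, **`termSize_ne9_and_fadingMemory_compProj_fed_on`**, **`termSize_ne9_and_fadingMemory_margProj_fed_on`**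
  — `NE9SizeFedCoupling` §1–§2 (p215561) re-cut.
Part 3 (`NE9SizeFedCouplingSpeciesReadOutOn`) re-cuts the END of record itself.  WHY the re-cut (sheet §2, part 1's header): for the
table slot of NE9's chart face — read by a measure-theoretic activity on tables MEASURABLE in the field argument, over an index that
codes the field POINTWISE — a total reading `ρ k` with `hρ` AND the full-box `hbox` into an honest `𝒜 k` has no construction,
whereas arising tables (channels of ADMISSIBLE families) are regular; the END USES only the arising case.  Every landed END remains a
corollary of its twin (`NE9BridgeSizeInductionOn.hboxOn_of_hbox`).  DISGUISE TEST: a binder WEAKENED to its use; no estimate.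

References (TYPES only): [Balaban1987RG1] T. Bałaban, CMP **109** (1987) 249–301, (0.28)–(0.29) p. 258, (1.3) p. 260, (1.18)
p. 263, (1.20)–(1.22) p. 264, (2.12)–(2.14) p. 268; [Balaban1988RG2Cluster] T. Bałaban, CMP **116** (1988) 1–22, (1.33)–(1.36) p. 9,
Lemma 3 (2.38) p. 20, (2.41) p. 21.  Summits-side NEW work (LEAN PLACEMENT RULE); imports part 1 and `NE9SizeFedCoupling` BY NAME;
modifies nothing.
-/

noncomputable section

namespace Summit.QuantumFields.BalabanUV.T4Continuum.NE9EndChainOn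

open scoped BigOperators
open Metric Set
open Literature.MathematicalPhysics.QuantumFieldTheory.Balaban1983to89
open Literature.MathematicalPhysics.QuantumFieldTheory.Balaban1983to89.T4OutputRate
open Literature.MathematicalPhysics.QuantumFieldTheory.Balaban1983to89.T4HistoryLipschitzRecursion
open Literature.MathematicalPhysics.QuantumFieldTheory.Balaban1983to89.T4HistoryLipschitzOuter
open Literature.MathematicalPhysics.QuantumFieldTheory.Balaban1983to89.T4HistoryLipschitzActivity
open Literature.MathematicalPhysics.QuantumFieldTheory.Balaban1983to89.T4HistoryLipschitzActivity (ClusterGeom)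
open Literature.MathematicalPhysics.QuantumFieldTheory.Balaban1983to89.T4HistoryLipschitzSegment
open Summit.QuantumFields.BalabanUV.T4Continuum.NE9LastCouplingBridge
open Summit.QuantumFields.BalabanUV.T4Continuum.NE9BridgeSizeInduction
open Summit.QuantumFields.BalabanUV.T4Continuum.NE9BridgeSizeInductionOn
open Summit.QuantumFields.BalabanUV.T4Continuum.NE9MarginalProjection
open Summit.QuantumFields.BalabanUV.T4Continuum.NE9MarginalProjectionEnd
open Summit.QuantumFields.BalabanUV.T4Continuum.NE9SizeFedCoupling

variable {C : Carriers} {Bg ι : Type}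

/-! ## §1 END-M `…_compProj` with `hboxOn` -/

/-- **END-M `…_compProj`, box read-out AT ARISING TABLES** — `NE9MarginalProjectionEnd.ne9_and_fadingMemory_of_couplingTwoPoint_vacSub
_sizeInduction_compProj` VERBATIM but for `hbox ↦ hboxOn` (at the arising tables `compProj 𝒯 P k g′ (E g)`); proof: part 1's bridge
twin at `T := compProj 𝒯 P`. [cite: Balaban1987RG1, (0.28)-(0.29) p.258, (1.3) p.260, (1.18) p.263, (2.12)-(2.14) p.268; Balaban1988RG2Cluster, (1.34)-(1.36) p.9, Lemma 3 (2.38) p.20] -/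
theorem ne9_and_fadingMemory_of_couplingTwoPoint_vacSub_sizeInduction_compProj_on (G : ClusterGeom C) {Pot : Type*}
    [NormedAddCommGroup Pot] [NormedSpace ℂ Pot] {E : Functional C Bg} {W : Set (ℕ → ℝ)} {Adm MF : Set (Bg → C.Dom → ℝ)}
    {P : (Bg → C.Dom → ℝ) → (Bg → C.Dom → ℝ)} {𝒯 : ℕ → (ℕ → ℝ) → (Bg → C.Dom → ℝ) → ι → ℝ}
    {Ψ : ℕ → ℝ → (ι → ℝ) → Bg → C.Dom → ℝ} {act : ℕ → ℝ → Bg → Pot → G.P → ℂ} {𝒜 : ℕ → Set Pot}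
    {n : ℕ → ℝ → Bg → G.P → ℝ} {lip clip : ℕ → ℝ} {a d : G.P → ℝ} {δ : C.Dom → ℝ}
    {κ B lipbar clipbar qTbar τbar ω c : ℝ} {wt : ℕ → ι → ℝ} {τ : ℕ → ℕ → ℝ} {qT p₀ N : ℕ → ℝ}
    (ρ : ℕ → (ι → ℝ) → Pot) (U₀ : Bg) (explZ : ℕ → Bg → C.Dom → ℝ) (h0 : ScaleZeroFree E W)
    (hAdm : AdmissibleTerms E W Adm) (hres : AdmRestrict Adm)
    -- the projection binders and the channel binders ON THE MARGINAL-FREE CLASS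
    (hPadd : ProjAdditive Adm P) (hPcomm : ProjScaleComm Adm P) (hPinto : ProjInto Adm MF P) (hPsize : ProjSize Adm P κ c)
    (hc : 0 ≤ c) (hadd : ChannelAdditive MF 𝒯) (hsum : ChannelStepSum MF 𝒯) (hstep : ChannelSizeAtStepNN MF 𝒯 κ wt τ)
    -- g21's remaining binders at `T := 𝒯 ∘ P`
    (hfac : Factorises E W (compProj 𝒯 P) Ψ) (hclip0 : ∀ k, 0 ≤ clip k)
    (hCup : ∀ g ∈ W, ∀ g' ∈ W, ∀ (k : ℕ) (U : Bg) (X : C.Dom), C.scale X = k + 1 → ∀ Q ∈ 𝒜 k, ∀ γ ∈ G.vol X,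
      ‖act k (g k) U Q γ‖ ≤ n k (g' k) U γ ∧
        ‖act k (g k) U Q γ - act k (g' k) U Q γ‖ ≤ clip k * |g k - g' k| * n k (g' k) U γ)
    (hqT0 : ∀ k, 0 ≤ qT k)
    (hTcup : ∀ g ∈ W, ∀ g' ∈ W, ∀ (k : ℕ) (y : ι),
      |compProj 𝒯 P k g (E g) y - compProj 𝒯 P k g' (E g) y| ≤ wt k y * (qT k * |g k - g' k|))
    (hreprV : ∀ (k : ℕ) (s : ℝ) (Q : ι → ℝ) (U : Bg) (X : C.Dom),
      Ψ k s Q U X = (G.newTerm act k s U X (ρ k Q)).re - (G.newTerm act k s U₀ X (ρ k Q)).re + explZ k U X)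
    (hclipb : ∀ k, clip k ≤ clipbar) (hqTb : ∀ k, qT k ≤ qTbar)
    (hK : TwoPointKP G W act 𝒜 n lip a d) (hdec : G.DecayExtract δ d) (hpin : G.PinBudget a δ (fun _ => B) κ)
    (hρ : ∀ (k : ℕ) (Q Q' : ι → ℝ) (M : ℝ), (∀ y, |Q y - Q' y| ≤ wt k y * M) → ‖ρ k Q - ρ k Q'‖ ≤ M)
    (hexplZ : ∀ (k : ℕ) (U : Bg) (X : C.Dom), C.scale X = k + 1 → |explZ k U X| ≤ Real.exp (-(κ * C.d X)) * p₀ k)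
    (hbase : ∀ g ∈ W, ∀ (U : Bg) (X : C.Dom), C.scale X = 0 → |E g U X| ≤ Real.exp (-(κ * C.d X)) * N 0)
    (hNsucc : ∀ j, p₀ j + 2 * B ≤ N (j + 1)) (hNnn : ∀ j, 0 ≤ N j)
    (hboxOn : ∀ (k : ℕ), ∀ g ∈ W, ∀ g' ∈ W, (∀ y, |compProj 𝒯 P k g' (E g) y| ≤
      wt k y * sizeRadius (fun k j => (1 + c) * τ k j) N k) → ρ k (compProj 𝒯 P k g' (E g)) ∈ 𝒜 k)
    (hB : 0 ≤ B) (hlipb : ∀ k, lip k ≤ lipbar) (hτbar : 0 ≤ τbar) (hω : 0 ≤ ω)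
    (hpos : 0 < ω + 8 * lipbar * B * ((1 + c) * τbar))
    (hτ : ∀ k j, j ≤ k → 0 ≤ τ k j ∧ τ k j ≤ τbar * ω ^ (k - j)) :
    TermSize E W κ N ∧
      NE9 E W κ (prodModuli (8 * clipbar * B + 8 * lipbar * B * qTbar)
        fun _ => ω + 8 * lipbar * B * ((1 + c) * τbar)) ∧
        FadingMemory ((8 * clipbar * B + 8 * lipbar * B * qTbar) / (ω + 8 * lipbar * B * ((1 + c) * τbar)))
          (ω + 8 * lipbar * B * ((1 + c) * τbar))
          (prodModuli (8 * clipbar * B + 8 * lipbar * B * qTbar) fun _ => ω + 8 * lipbar * B * ((1 + c) * τbar)) := by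
  have hτ' : ∀ k j, j ≤ k → 0 ≤ (1 + c) * τ k j ∧ (1 + c) * τ k j ≤ (1 + c) * τbar * ω ^ (k - j) :=
    compWeights_profile hc hτ
  have hτbar' : 0 ≤ (1 + c) * τbar := mul_nonneg (by linarith) hτbar
  exact ne9_and_fadingMemory_of_couplingTwoPoint_vacSub_sizeInduction_on G ρ U₀ explZ h0 hAdm hres
    (channelAdditive_compProj hPadd hPinto hadd) (channelStepSum_compProj hPcomm hPinto hsum)
    (channelSizeAtStepNN_compProj hPcomm hPinto hPsize hc hstep) hfac hclip0 hCup hqT0 hTcup hreprV hclipb hqTb hK hdec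
    hpin hρ hexplZ hbase hNsucc hNnn hboxOn hB hlipb hτbar' hω hpos hτ'

/-! ## §2 The size-first face and the size-fed faces with `hboxOn` -/

section Fed

variable (G : ClusterGeom C) {Pot : Type*} [NormedAddCommGroup Pot] [NormedSpace ℂ Pot]

omit [NormedSpace ℂ Pot] in
/-- **`TermSize` FIRST, box read-out AT ARISING TABLES** — `NE9SizeFedCoupling.termSize_compProj` VERBATIM but for `hbox ↦ hboxOn`;
proof: part 1's `termSize_of_recursion_vacSub_on`. [cite: Balaban1987RG1, (1.18) p.263, (0.23) p.256; Balaban1988RG2Cluster, (1.34)-(1.36) p.9, (2.41) p.21] -/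
theorem termSize_compProj_on {E : Functional C Bg} {W : Set (ℕ → ℝ)} {Adm MF : Set (Bg → C.Dom → ℝ)}
    {P : (Bg → C.Dom → ℝ) → (Bg → C.Dom → ℝ)} {𝒯 : ℕ → (ℕ → ℝ) → (Bg → C.Dom → ℝ) → ι → ℝ}
    {Ψ : ℕ → ℝ → (ι → ℝ) → Bg → C.Dom → ℝ} {act : ℕ → ℝ → Bg → Pot → G.P → ℂ} {𝒜 : ℕ → Set Pot}
    {n : ℕ → ℝ → Bg → G.P → ℝ} {lip : ℕ → ℝ} {a d : G.P → ℝ} {δ : C.Dom → ℝ}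
    {κ B c : ℝ} {wt : ℕ → ι → ℝ} {τ : ℕ → ℕ → ℝ} {p₀ N : ℕ → ℝ}
    (ρ : ℕ → (ι → ℝ) → Pot) (U₀ : Bg) (explZ : ℕ → Bg → C.Dom → ℝ)
    (hAdm : AdmissibleTerms E W Adm) (hres : AdmRestrict Adm)
    (hPcomm : ProjScaleComm Adm P) (hPinto : ProjInto Adm MF P) (hPsize : ProjSize Adm P κ c) (hc : 0 ≤ c)
    (hsum : ChannelStepSum MF 𝒯) (hstep : ChannelSizeAtStepNN MF 𝒯 κ wt τ)
    (hfac : Factorises E W (compProj 𝒯 P) Ψ)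
    (hreprV : ∀ (k : ℕ) (s : ℝ) (Q : ι → ℝ) (U : Bg) (X : C.Dom),
      Ψ k s Q U X = (G.newTerm act k s U X (ρ k Q)).re - (G.newTerm act k s U₀ X (ρ k Q)).re + explZ k U X)
    (hK : TwoPointKP G W act 𝒜 n lip a d) (hdec : G.DecayExtract δ d) (hpin : G.PinBudget a δ (fun _ => B) κ)
    (hexplZ : ∀ (k : ℕ) (U : Bg) (X : C.Dom), C.scale X = k + 1 → |explZ k U X| ≤ Real.exp (-(κ * C.d X)) * p₀ k)
    (hbase : ∀ g ∈ W, ∀ (U : Bg) (X : C.Dom), C.scale X = 0 → |E g U X| ≤ Real.exp (-(κ * C.d X)) * N 0)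
    (hNsucc : ∀ j, p₀ j + 2 * B ≤ N (j + 1)) (hNnn : ∀ j, 0 ≤ N j)
    (hboxOn : ∀ (k : ℕ), ∀ g ∈ W, ∀ g' ∈ W, (∀ y, |compProj 𝒯 P k g' (E g) y| ≤
      wt k y * sizeRadius (fun k j => (1 + c) * τ k j) N k) → ρ k (compProj 𝒯 P k g' (E g)) ∈ 𝒜 k) :
    TermSize E W κ N :=
  (termSize_of_recursion_vacSub_on G ρ U₀ explZ hAdm
    (channelSizeNN_of_perStepNN hres (channelStepSum_compProj hPcomm hPinto hsum)
      (channelSizeAtStepNN_compProj hPcomm hPinto hPsize hc hstep))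
    hfac hK hdec hpin hreprV hexplZ hbase hNsucc hNnn hboxOn).1

/-- **END-M `…_compProj` WITH A SIZE-FED `hTcup`, box read-out AT ARISING TABLES** — `NE9SizeFedCoupling.termSize_ne9_and_fadingMemory
_compProj_fed` VERBATIM but for `hbox ↦ hboxOn`. [cite: Balaban1987RG1, (0.28)-(0.30) p.258, (1.3) p.260, (1.18) p.263, (2.12)-(2.14) p.268; Balaban1988RG2Cluster, (1.33)-(1.36) p.9, Lemma 3 (2.38) p.20] -/
theorem termSize_ne9_and_fadingMemory_compProj_fed_on {E : Functional C Bg} {W : Set (ℕ → ℝ)} {Adm MF : Set (Bg → C.Dom → ℝ)}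
    {P : (Bg → C.Dom → ℝ) → (Bg → C.Dom → ℝ)} {𝒯 : ℕ → (ℕ → ℝ) → (Bg → C.Dom → ℝ) → ι → ℝ}
    {Ψ : ℕ → ℝ → (ι → ℝ) → Bg → C.Dom → ℝ} {act : ℕ → ℝ → Bg → Pot → G.P → ℂ} {𝒜 : ℕ → Set Pot}
    {n : ℕ → ℝ → Bg → G.P → ℝ} {lip clip : ℕ → ℝ} {a d : G.P → ℝ} {δ : C.Dom → ℝ}
    {κ B lipbar clipbar qTbar τbar ω c : ℝ} {wt : ℕ → ι → ℝ} {τ : ℕ → ℕ → ℝ} {qT p₀ N : ℕ → ℝ}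
    (ρ : ℕ → (ι → ℝ) → Pot) (U₀ : Bg) (explZ : ℕ → Bg → C.Dom → ℝ) (h0 : ScaleZeroFree E W)
    (hAdm : AdmissibleTerms E W Adm) (hres : AdmRestrict Adm)
    (hPadd : ProjAdditive Adm P) (hPcomm : ProjScaleComm Adm P) (hPinto : ProjInto Adm MF P) (hPsize : ProjSize Adm P κ c)
    (hc : 0 ≤ c) (hadd : ChannelAdditive MF 𝒯) (hsum : ChannelStepSum MF 𝒯) (hstep : ChannelSizeAtStepNN MF 𝒯 κ wt τ)
    (hfac : Factorises E W (compProj 𝒯 P) Ψ) (hclip0 : ∀ k, 0 ≤ clip k)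
    (hCup : ∀ g ∈ W, ∀ g' ∈ W, ∀ (k : ℕ) (U : Bg) (X : C.Dom), C.scale X = k + 1 → ∀ Q ∈ 𝒜 k, ∀ γ ∈ G.vol X,
      ‖act k (g k) U Q γ‖ ≤ n k (g' k) U γ ∧
        ‖act k (g k) U Q γ - act k (g' k) U Q γ‖ ≤ clip k * |g k - g' k| * n k (g' k) U γ)
    (hqT0 : ∀ k, 0 ≤ qT k)
    (hTcupFed : TermSize E W κ N → ∀ g ∈ W, ∀ g' ∈ W, ∀ (k : ℕ) (y : ι),
      |compProj 𝒯 P k g (E g) y - compProj 𝒯 P k g' (E g) y| ≤ wt k y * (qT k * |g k - g' k|))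
    (hreprV : ∀ (k : ℕ) (s : ℝ) (Q : ι → ℝ) (U : Bg) (X : C.Dom),
      Ψ k s Q U X = (G.newTerm act k s U X (ρ k Q)).re - (G.newTerm act k s U₀ X (ρ k Q)).re + explZ k U X)
    (hclipb : ∀ k, clip k ≤ clipbar) (hqTb : ∀ k, qT k ≤ qTbar)
    (hK : TwoPointKP G W act 𝒜 n lip a d) (hdec : G.DecayExtract δ d) (hpin : G.PinBudget a δ (fun _ => B) κ)
    (hρ : ∀ (k : ℕ) (Q Q' : ι → ℝ) (M : ℝ), (∀ y, |Q y - Q' y| ≤ wt k y * M) → ‖ρ k Q - ρ k Q'‖ ≤ M)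
    (hexplZ : ∀ (k : ℕ) (U : Bg) (X : C.Dom), C.scale X = k + 1 → |explZ k U X| ≤ Real.exp (-(κ * C.d X)) * p₀ k)
    (hbase : ∀ g ∈ W, ∀ (U : Bg) (X : C.Dom), C.scale X = 0 → |E g U X| ≤ Real.exp (-(κ * C.d X)) * N 0)
    (hNsucc : ∀ j, p₀ j + 2 * B ≤ N (j + 1)) (hNnn : ∀ j, 0 ≤ N j)
    (hboxOn : ∀ (k : ℕ), ∀ g ∈ W, ∀ g' ∈ W, (∀ y, |compProj 𝒯 P k g' (E g) y| ≤
      wt k y * sizeRadius (fun k j => (1 + c) * τ k j) N k) → ρ k (compProj 𝒯 P k g' (E g)) ∈ 𝒜 k)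
    (hB : 0 ≤ B) (hlipb : ∀ k, lip k ≤ lipbar) (hτbar : 0 ≤ τbar) (hω : 0 ≤ ω)
    (hpos : 0 < ω + 8 * lipbar * B * ((1 + c) * τbar))
    (hτ : ∀ k j, j ≤ k → 0 ≤ τ k j ∧ τ k j ≤ τbar * ω ^ (k - j)) :
    TermSize E W κ N ∧
      NE9 E W κ (prodModuli (8 * clipbar * B + 8 * lipbar * B * qTbar)
        fun _ => ω + 8 * lipbar * B * ((1 + c) * τbar)) ∧
        FadingMemory ((8 * clipbar * B + 8 * lipbar * B * qTbar) / (ω + 8 * lipbar * B * ((1 + c) * τbar)))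
          (ω + 8 * lipbar * B * ((1 + c) * τbar))
          (prodModuli (8 * clipbar * B + 8 * lipbar * B * qTbar) fun _ => ω + 8 * lipbar * B * ((1 + c) * τbar)) := by
  have hT : TermSize E W κ N := termSize_compProj_on G ρ U₀ explZ hAdm hres hPcomm hPinto hPsize hc hsum hstep hfac hreprV hK
    hdec hpin hexplZ hbase hNsucc hNnn hboxOn
  exact ne9_and_fadingMemory_of_couplingTwoPoint_vacSub_sizeInduction_compProj_on G ρ U₀ explZ h0 hAdm hres hPadd hPcomm hPinto
    hPsize hc hadd hsum hstep hfac hclip0 hCup hqT0 (hTcupFed hT) hreprV hclipb hqTb hK hdec hpin hρ hexplZ hbase hNsucc hNnn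
    hboxOn hB hlipb hτbar hω hpos hτ

/-- **END-M `…_margProj` WITH A SIZE-FED `hTcup`, box read-out AT ARISING TABLES** (`P := margProj r A`, `c := cr·aA`) —
`NE9SizeFedCoupling.termSize_ne9_and_fadingMemory_margProj_fed` VERBATIM but for `hbox ↦ hboxOn`.
[cite: Balaban1987RG1, (0.28)-(0.29) p.258, (1.3) p.260, (1.20)-(1.22) p.264] -/
theorem termSize_ne9_and_fadingMemory_margProj_fed_on {E : Functional C Bg} {W : Set (ℕ → ℝ)} {Adm MF : Set (Bg → C.Dom → ℝ)}
    {r : ℕ → (Bg → C.Dom → ℝ) → ℝ} {A : Bg → C.Dom → ℝ} {𝒯 : ℕ → (ℕ → ℝ) → (Bg → C.Dom → ℝ) → ι → ℝ}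
    {Ψ : ℕ → ℝ → (ι → ℝ) → Bg → C.Dom → ℝ} {act : ℕ → ℝ → Bg → Pot → G.P → ℂ} {𝒜 : ℕ → Set Pot}
    {n : ℕ → ℝ → Bg → G.P → ℝ} {lip clip : ℕ → ℝ} {a d : G.P → ℝ} {δ : C.Dom → ℝ}
    {κ B lipbar clipbar qTbar τbar ω cr aA : ℝ} {wt : ℕ → ι → ℝ} {τ : ℕ → ℕ → ℝ} {qT p₀ N : ℕ → ℝ}
    (ρ : ℕ → (ι → ℝ) → Pot) (U₀ : Bg) (explZ : ℕ → Bg → C.Dom → ℝ) (h0 : ScaleZeroFree E W)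
    (hAdm : AdmissibleTerms E W Adm) (hres : AdmRestrict Adm)
    (hrA : ReadAdditive Adm r) (hr0 : ReadZero r) (hrs : ReadSize Adm r κ cr) (hA : DirSize A κ aA) (hcr : 0 ≤ cr)
    (haA : 0 ≤ aA) (hPinto : ProjInto Adm MF (margProj r A))
    (hadd : ChannelAdditive MF 𝒯) (hsum : ChannelStepSum MF 𝒯) (hstep : ChannelSizeAtStepNN MF 𝒯 κ wt τ)
    (hfac : Factorises E W (compProj 𝒯 (margProj r A)) Ψ) (hclip0 : ∀ k, 0 ≤ clip k)
    (hCup : ∀ g ∈ W, ∀ g' ∈ W, ∀ (k : ℕ) (U : Bg) (X : C.Dom), C.scale X = k + 1 → ∀ Q ∈ 𝒜 k, ∀ γ ∈ G.vol X,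
      ‖act k (g k) U Q γ‖ ≤ n k (g' k) U γ ∧
        ‖act k (g k) U Q γ - act k (g' k) U Q γ‖ ≤ clip k * |g k - g' k| * n k (g' k) U γ)
    (hqT0 : ∀ k, 0 ≤ qT k)
    (hTcupFed : TermSize E W κ N → ∀ g ∈ W, ∀ g' ∈ W, ∀ (k : ℕ) (y : ι),
      |compProj 𝒯 (margProj r A) k g (E g) y - compProj 𝒯 (margProj r A) k g' (E g) y| ≤
        wt k y * (qT k * |g k - g' k|))
    (hreprV : ∀ (k : ℕ) (s : ℝ) (Q : ι → ℝ) (U : Bg) (X : C.Dom),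
      Ψ k s Q U X = (G.newTerm act k s U X (ρ k Q)).re - (G.newTerm act k s U₀ X (ρ k Q)).re + explZ k U X)
    (hclipb : ∀ k, clip k ≤ clipbar) (hqTb : ∀ k, qT k ≤ qTbar)
    (hK : TwoPointKP G W act 𝒜 n lip a d) (hdec : G.DecayExtract δ d) (hpin : G.PinBudget a δ (fun _ => B) κ)
    (hρ : ∀ (k : ℕ) (Q Q' : ι → ℝ) (M : ℝ), (∀ y, |Q y - Q' y| ≤ wt k y * M) → ‖ρ k Q - ρ k Q'‖ ≤ M)
    (hexplZ : ∀ (k : ℕ) (U : Bg) (X : C.Dom), C.scale X = k + 1 → |explZ k U X| ≤ Real.exp (-(κ * C.d X)) * p₀ k)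
    (hbase : ∀ g ∈ W, ∀ (U : Bg) (X : C.Dom), C.scale X = 0 → |E g U X| ≤ Real.exp (-(κ * C.d X)) * N 0)
    (hNsucc : ∀ j, p₀ j + 2 * B ≤ N (j + 1)) (hNnn : ∀ j, 0 ≤ N j)
    (hboxOn : ∀ (k : ℕ), ∀ g ∈ W, ∀ g' ∈ W, (∀ y, |compProj 𝒯 (margProj r A) k g' (E g) y| ≤
      wt k y * sizeRadius (fun k j => (1 + cr * aA) * τ k j) N k) → ρ k (compProj 𝒯 (margProj r A) k g' (E g)) ∈ 𝒜 k)
    (hB : 0 ≤ B) (hlipb : ∀ k, lip k ≤ lipbar) (hτbar : 0 ≤ τbar) (hω : 0 ≤ ω)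
    (hpos : 0 < ω + 8 * lipbar * B * ((1 + cr * aA) * τbar))
    (hτ : ∀ k j, j ≤ k → 0 ≤ τ k j ∧ τ k j ≤ τbar * ω ^ (k - j)) :
    TermSize E W κ N ∧
      NE9 E W κ (prodModuli (8 * clipbar * B + 8 * lipbar * B * qTbar)
        fun _ => ω + 8 * lipbar * B * ((1 + cr * aA) * τbar)) ∧
        FadingMemory ((8 * clipbar * B + 8 * lipbar * B * qTbar) / (ω + 8 * lipbar * B * ((1 + cr * aA) * τbar)))
          (ω + 8 * lipbar * B * ((1 + cr * aA) * τbar))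
          (prodModuli (8 * clipbar * B + 8 * lipbar * B * qTbar) fun _ => ω + 8 * lipbar * B * ((1 + cr * aA) * τbar)) :=
  termSize_ne9_and_fadingMemory_compProj_fed_on G ρ U₀ explZ h0 hAdm hres (projAdditive_margProj A hrA)
    (projScaleComm_margProj Adm A hr0) hPinto (projSize_margProj hrs hA hcr) (mul_nonneg hcr haA) hadd hsum hstep hfac hclip0
    hCup hqT0 hTcupFed hreprV hclipb hqTb hK hdec hpin hρ hexplZ hbase hNsucc hNnn hboxOn hB hlipb hτbar hω hpos hτ

end Fed

end Summit.QuantumFields.BalabanUV.T4Continuum.NE9EndChainOn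

end
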